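import Mathlib.Algebra.Homology.DerivedCategory.ExactFunctor
import Mathlib.CategoryTheory.Localization.LocalizerMorphism
import Mathlib.CategoryTheory.Adjunction.Limits
import HarnessLib

/-!
# The functor on derived categories induced by an equivalence of abelian categories is an equivalence

For an additive equivalence `F : C₁ ⥤ C₂` between abelian categories (with chosen derived categories,
Mathlib `HasDerivedCategory`), Mathlib's `F.mapDerivedCategory : D(C₁) ⥤ D(C₂)`
(`Mathlib/Algebra/Homology/DerivedCategory/ExactFunctor.lean`: defined as the localized functor of the
localizer morphism `F.mapHomologicalComplex (ComplexShape.up ℤ)` for the classes of quasi-isomorphisms)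
**is an equivalence of categories** — hence full and faithful:

* `isEquivalence_mapHomologicalComplex` — `F.mapHomologicalComplex c` is an equivalence
  (Mathlib `Equivalence.mapHomologicalComplex` of `F.asEquivalence`);
* `isInduced_mapHomologicalComplexUpToQuasiIso` — quasi-isomorphisms CORRESPOND under it: `F` preserves
  homology and reflects isomorphisms (Mathlib `quasiIso_map_iff_of_preservesHomology`);
* `isLocalizedEquivalence_mapHomologicalComplexUpToQuasiIso` — so the localizer morphism is a localized
  equivalence (Mathlib `LocalizerMorphism.isLocalizedEquivalence_of_isInduced`), and
* **`mapDerivedCategory_isEquivalence`** — `F.mapDerivedCategory.IsEquivalence`;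
* `nonempty_shiftHomEquiv_of_isEquivalence` — consequently, for cochain complexes `K, L` and `n : ℤ`, `D(F)` and its
  factorisation `Q ⋙ D(F) ≅ F• ⋙ Q` (Mathlib `mapDerivedCategoryFactors`) give a BIJECTION
  `Hom_{D(C₁)}(Q K, (Q L)⟦n⟧) ≃ Hom_{D(C₂)}(Q (F• K), (Q (F• L))⟦n⟧)`, and `subsingleton_shiftHom_iff` —
  `Hom_{D(C₂)}(Q (F• K), (Q (F• K))⟦n⟧)` is trivial iff `Hom_{D(C₁)}(Q K, (Q K)⟦n⟧)` is
  (the «`Ext^{<0} = 0`» clause of gluability transports along `F`).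

This is the input named by the cell `pub-hodge-ring2` (bus 2026-08-27, ring2-b02 gen 87 → ring2-b06: «NO Mathlib∕tree
lemma that `mapDerivedCategory` of an EQUIVALENCE is full∕faithful») for transporting the venture HSemireg's
σ-admissibility notion along an isomorphism of the base scheme. Pure category theory; everything PROVED;
THEOREMS ONLY (no definition, no named fact).

References: C. A. Weibel, *An introduction to homological algebra* (1994), §10.4 (the derived category as the
localisation at quasi-isomorphisms; Cor. 10.4.7) [Weibel1994]; the statements are folklore bookkeeping
(an equivalence of abelian categories induces an equivalence of derived categories).
-/

universe w₁ w₂ v₁ v₂ u₁ u₂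

open CategoryTheory Category Limits

namespace Literature.Algebra.Homology

variable {C₁ : Type u₁} [Category.{v₁} C₁] [Abelian C₁] [HasDerivedCategory.{w₁} C₁]
  {C₂ : Type u₂} [Category.{v₂} C₂] [Abelian C₂] [HasDerivedCategory.{w₂} C₂]
  (F : C₁ ⥤ C₂) [F.Additive] [F.IsEquivalence]

omit [HasDerivedCategory C₁] [HasDerivedCategory C₂] in
/-- For an equivalence `F`, `F.mapHomologicalComplex c` is an equivalence of categories of complexes
(Mathlib `Equivalence.mapHomologicalComplex`). [cite: Weibel1994, §10.4 (reading: an equivalence of abelian categories acts on complexes and quasi-isomorphisms)] -/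
theorem isEquivalence_mapHomologicalComplex {ι : Type*} (c : ComplexShape ι) :
    (F.mapHomologicalComplex c).IsEquivalence :=
  (F.asEquivalence.mapHomologicalComplex c).isEquivalence_functor

omit [HasDerivedCategory C₁] [HasDerivedCategory C₂] in
/-- For an equivalence `F`, a morphism of cochain complexes is a quasi-isomorphism iff its image under `F•` is
(`F` preserves homology and reflects isomorphisms): the localizer morphism `F•` between the classes of
quasi-isomorphisms is INDUCED. [cite: Weibel1994, Cor. 10.4.7 (localisation at quasi-isomorphisms)] -/
theorem isInduced_mapHomologicalComplexUpToQuasiIso :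
    (F.mapHomologicalComplexUpToQuasiIsoLocalizerMorphism (ComplexShape.up ℤ)).IsInduced where
  inverseImage_eq := by
    refine MorphismProperty.ext _ _ fun K L f => ?_
    change QuasiIso ((F.mapHomologicalComplex (ComplexShape.up ℤ)).map f) ↔ QuasiIso f
    exact HomologicalComplex.quasiIso_map_iff_of_preservesHomology f F

omit [HasDerivedCategory C₁] [HasDerivedCategory C₂] in
/-- For an equivalence `F`, the localizer morphism `F•` (quasi-isomorphisms to quasi-isomorphisms) is a
LOCALIZED EQUIVALENCE (Mathlib `LocalizerMorphism.isLocalizedEquivalence_of_isInduced`).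
[cite: Weibel1994, Cor. 10.4.7 (localisation at quasi-isomorphisms)] -/
theorem isLocalizedEquivalence_mapHomologicalComplexUpToQuasiIso :
    (F.mapHomologicalComplexUpToQuasiIsoLocalizerMorphism (ComplexShape.up ℤ)).IsLocalizedEquivalence := by
  haveI : (F.mapHomologicalComplexUpToQuasiIsoLocalizerMorphism (ComplexShape.up ℤ)).functor.IsEquivalence :=
    isEquivalence_mapHomologicalComplex F _
  haveI := isInduced_mapHomologicalComplexUpToQuasiIso F
  exact LocalizerMorphism.isLocalizedEquivalence_of_isInduced _

/-- **The functor `D(F) : D(C₁) ⥤ D(C₂)` induced by an additive EQUIVALENCE `F` of abelian categories is an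
equivalence of categories** (hence full and faithful). [cite: Weibel1994, §10.4 and Cor. 10.4.7] -/
theorem mapDerivedCategory_isEquivalence : F.mapDerivedCategory.IsEquivalence := by
  haveI := isLocalizedEquivalence_mapHomologicalComplexUpToQuasiIso F
  exact LocalizerMorphism.localizedFunctor_isEquivalence
    (F.mapHomologicalComplexUpToQuasiIsoLocalizerMorphism (ComplexShape.up ℤ)) DerivedCategory.Q DerivedCategory.Q

/-- `D(F)` is full for an equivalence `F`. [cite: Weibel1994, §10.4 and Cor. 10.4.7] -/
theorem mapDerivedCategory_full : F.mapDerivedCategory.Full := by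
  haveI := mapDerivedCategory_isEquivalence F; infer_instance

/-- `D(F)` is faithful for an equivalence `F`. [cite: Weibel1994, §10.4 and Cor. 10.4.7] -/
theorem mapDerivedCategory_faithful : F.mapDerivedCategory.Faithful := by
  haveI := mapDerivedCategory_isEquivalence F; infer_instance

/-- **Shifted Homs between complexes transport bijectively along `D(F)`** for an equivalence `F`: there is a
bijection `Hom_{D(C₁)}(Q K, (Q L)⟦n⟧) ≃ Hom_{D(C₂)}(Q (F• K), (Q (F• L))⟦n⟧)` — namely `D(F)` on morphisms (fully
faithful) followed by conjugation with `D(F)(Q K) ≅ Q(F• K)` (Mathlib `mapDerivedCategoryFactors`) and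
`D(F)((Q L)⟦n⟧) ≅ (D(F)(Q L))⟦n⟧ ≅ (Q (F• L))⟦n⟧` (`commShiftIso`). Stated as `Nonempty (_ ≃ _)` (no auxiliary
definition). [cite: Weibel1994, §10.4 and Cor. 10.4.7] -/
theorem nonempty_shiftHomEquiv_of_isEquivalence (K L : CochainComplex C₁ ℤ) (n : ℤ) :
    Nonempty ((DerivedCategory.Q.obj K ⟶ (shiftFunctor (DerivedCategory C₁) n).obj (DerivedCategory.Q.obj L)) ≃
      (DerivedCategory.Q.obj ((F.mapHomologicalComplex (ComplexShape.up ℤ)).obj K) ⟶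
        (shiftFunctor (DerivedCategory C₂) n).obj
          (DerivedCategory.Q.obj ((F.mapHomologicalComplex (ComplexShape.up ℤ)).obj L)))) := by
  haveI := mapDerivedCategory_full F
  haveI := mapDerivedCategory_faithful F
  exact ⟨((Functor.FullyFaithful.ofFullyFaithful F.mapDerivedCategory).homEquiv).trans
    (Iso.homCongr (F.mapDerivedCategoryFactors.app K)
      ((F.mapDerivedCategory.commShiftIso n).app (DerivedCategory.Q.obj L) ≪≫
        (shiftFunctor (DerivedCategory C₂) n).mapIso (F.mapDerivedCategoryFactors.app L)))⟩

/-- Hence `Hom_{D(C₂)}(Q (F• K), (Q (F• L))⟦n⟧)` is trivial iff `Hom_{D(C₁)}(Q K, (Q L)⟦n⟧)` is — for `K = L` and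
`n < 0` this is the transport of Lieblich's gluability condition `Ext^{<0}(K, K) = 0` along `F`.
[cite: Weibel1994, §10.4 and Cor. 10.4.7] -/
theorem subsingleton_shiftHom_iff (K L : CochainComplex C₁ ℤ) (n : ℤ) :
    Subsingleton (DerivedCategory.Q.obj ((F.mapHomologicalComplex (ComplexShape.up ℤ)).obj K) ⟶
        (shiftFunctor (DerivedCategory C₂) n).obj
          (DerivedCategory.Q.obj ((F.mapHomologicalComplex (ComplexShape.up ℤ)).obj L))) ↔
      Subsingleton (DerivedCategory.Q.obj K ⟶ (shiftFunctor (DerivedCategory C₁) n).obj (DerivedCategory.Q.obj L)) := by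
  obtain ⟨e⟩ := nonempty_shiftHomEquiv_of_isEquivalence F K L n
  exact (Equiv.subsingleton_congr e).symm

end Literature.Algebra.Homology
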